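import Summits.RiemannHypothesis.RiemannHypothesis.Theorems.PfPersistenceBarrierTwinsDials
import Summits.RiemannHypothesis.RiemannHypothesis.Theorems.RuelleBandExactFirstBandStubEvenCriterion
import Literature.NumberTheory.LFunctions.WeilExplicitProofs
import HarnessLib

/-!
# PF-persistence barrier, part V: REALPAIR-MONO — even-sector monotone criteria are blind to a
planted real pair (PROVED, RH-free)

LONG-ODDS MECHANISM SEARCH; NO RH CLAIMS.  Value = a rigidity wall for the cell's case DAG
(`CASE-DAG.md` leaf G1.SECT, lemma REALPAIR-MONO; negative control FK-REALPAIR).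

The control "ζ with a planted REAL PAIR of zeros `{1/2 + η, 1/2 − η}`" is the explicit-formula datum
`realPairDatum η`: `ζ`'s datum with the zero-side contribution `k̂(1/2+η) + k̂(1/2−η)` of the pair
added to the smooth part (`realPairTerm`).  On the autoconvolution `g ⋆ g̃` of a test `g` this term is
`ĝ(1/2+η)·conj ĝ(1/2−η) + ĝ(1/2−η)·conj ĝ(1/2+η)` (`realPairTerm_conv_reflect`, from the tree's
`weilMellin_weilConv_holds`, `weilMellin_weilReflect_holds`), hence

* `+ 2‖ĝ(1/2+η)‖²` on EVEN tests (`realPairTerm_of_isEven`): the even-sector form of the control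
  DOMINATES `ζ`'s (`zetaDatum_evenDominates_realPairDatum`), so every EVEN-MONOTONE criterion holding
  at `ζ` holds at the control (`realPair_of_isEvenMonotone`) and none discriminates `ζ` from a class of
  negatives containing a planted real pair (`no_evenMonotone_discriminator`);
* `− 2‖ĝ(1/2+η)‖²` on ODD tests (`realPairTerm_of_isOdd`): the pair is visible only in the odd sector
  (`realPairDatum_oddDominated`).

In particular the even real-test Weil criterion — which for `ζ` IS `RiemannHypothesis`
(tree `riemannHypothesis_iff_evenWeilPositivity`; here `evenRealPositivity_zetaDatum_iff`) — transfers
from `ζ` to every planted real pair (`evenRealPositivity_realPairDatum`): its RH-strength for `ζ` rests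
on `ζ` having no zeros on `(0, 1)`, not on anything an even-sector functional can measure.  Whether
`realPairDatum η` violates full positivity is NOT asserted (it is the binder `realPairDatum η ∈ Neg`).
-/

set_option linter.dupNamespace false

noncomputable section

open MeasureTheory Set Complex
open scoped Real ComplexConjugate ContDiff

namespace Summit.RiemannHypothesis.RiemannHypothesis.Theorems.PfPersistenceBarrier

open Literature.NumberTheory.LFunctions

/-! ## Even and odd tests; Mellin values at real points symmetric about `1/2` -/

/-- Even test: `g(−t) = g(t)`. [folklore] -/
def IsEven (g : ℝ → ℂ) : Prop := ∀ t : ℝ, g (-t) = g t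

/-- Odd test: `g(−t) = −g(t)`. [folklore] -/
def IsOdd (g : ℝ → ℂ) : Prop := ∀ t : ℝ, g (-t) = -g t

/-- For an even `g`: `ĝ(1/2 − η) = ĝ(1/2 + η)` (substitute `t ↦ −t`). [folklore] -/
theorem weilMellin_half_sub_of_isEven {g : ℝ → ℂ} (hg : IsEven g) (η : ℝ) :
    weilMellin g ((1 / 2 - η : ℝ) : ℂ) = weilMellin g ((1 / 2 + η : ℝ) : ℂ) := by
  unfold weilMellin
  have h := integral_neg_eq_self
    (fun t : ℝ ↦ g t * cexp ((((1 / 2 + η : ℝ) : ℂ) - 1 / 2) * (t : ℂ))) volume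
  rw [← h]
  congr 1
  funext t
  rw [hg t]
  congr 1
  push_cast
  ring_nf

/-- For an odd `g`: `ĝ(1/2 − η) = −ĝ(1/2 + η)`. [folklore] -/
theorem weilMellin_half_sub_of_isOdd {g : ℝ → ℂ} (hg : IsOdd g) (η : ℝ) :
    weilMellin g ((1 / 2 - η : ℝ) : ℂ) = -weilMellin g ((1 / 2 + η : ℝ) : ℂ) := by
  unfold weilMellin
  have h := integral_neg_eq_self
    (fun t : ℝ ↦ g t * cexp ((((1 / 2 + η : ℝ) : ℂ) - 1 / 2) * (t : ℂ))) volume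
  rw [← h, ← integral_neg]
  congr 1
  funext t
  rw [hg t, neg_mul, neg_neg]
  congr 1
  push_cast
  ring_nf

/-! ## The planted real pair as an explicit-formula datum -/

/-- The zero-side contribution `k̂(1/2+η) + k̂(1/2−η)` of a planted REAL PAIR `{1/2 ± η}`. [folklore] -/
def realPairTerm (η : ℝ) (k : ℝ → ℂ) : ℂ :=
  weilMellin k ((1 / 2 + η : ℝ) : ℂ) + weilMellin k ((1 / 2 - η : ℝ) : ℂ)

/-- `ζ` WITH A PLANTED REAL PAIR `{1/2 ± η}` (control family FK-REALPAIR): same point masses as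
`zetaDatum`, smooth part augmented by `realPairTerm η`. [folklore] -/
def realPairDatum (η : ℝ) : ExplicitDatum where
  smooth k := zetaDatum.smooth k + realPairTerm η k
  pos := zetaDatum.pos
  wt := zetaDatum.wt

/-- `Q_pair(g) = Q_ζ(g) + realPairTerm η (g ⋆ g̃)`. [folklore] -/
theorem realPairDatum_quadratic (η : ℝ) (g : ℝ → ℂ) :
    (realPairDatum η).quadratic g =
      zetaDatum.quadratic g + realPairTerm η (weilConv g (weilReflect g)) := by
  simp only [ExplicitDatum.quadratic, ExplicitDatum.functional, ExplicitDatum.primeTerm, realPairDatum]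
  ring

/-- On an autoconvolution: `realPairTerm η (g ⋆ g̃) = ĝ(σ₊)·conj ĝ(σ₋) + ĝ(σ₋)·conj ĝ(σ₊)`,
`σ± = 1/2 ± η`. [folklore] -/
theorem realPairTerm_conv_reflect {g : ℝ → ℂ} (hg : IsWeilTest g) (η : ℝ) :
    realPairTerm η (weilConv g (weilReflect g)) =
      weilMellin g ((1 / 2 + η : ℝ) : ℂ) * conj (weilMellin g ((1 / 2 - η : ℝ) : ℂ)) +
        weilMellin g ((1 / 2 - η : ℝ) : ℂ) * conj (weilMellin g ((1 / 2 + η : ℝ) : ℂ)) := by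
  have hr := hg.weilReflect
  have e₁ : (1 : ℂ) - conj (((1 / 2 + η : ℝ)) : ℂ) = ((1 / 2 - η : ℝ) : ℂ) := by
    rw [Complex.conj_ofReal]; push_cast; ring
  have e₂ : (1 : ℂ) - conj (((1 / 2 - η : ℝ)) : ℂ) = ((1 / 2 + η : ℝ) : ℂ) := by
    rw [Complex.conj_ofReal]; push_cast; ring
  unfold realPairTerm
  rw [weilMellin_weilConv_holds hg.1.continuous hg.2 hr.1.continuous hr.2,
    weilMellin_weilConv_holds hg.1.continuous hg.2 hr.1.continuous hr.2,
    weilMellin_weilReflect_holds, weilMellin_weilReflect_holds, e₁, e₂]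

/-- EVEN tests: `realPairTerm η (g ⋆ g̃) = 2‖ĝ(1/2+η)‖² ≥ 0`. [folklore] -/
theorem realPairTerm_of_isEven {g : ℝ → ℂ} (hg : IsWeilTest g) (he : IsEven g) (η : ℝ) :
    realPairTerm η (weilConv g (weilReflect g)) =
      ((2 * ‖weilMellin g ((1 / 2 + η : ℝ) : ℂ)‖ ^ 2 : ℝ) : ℂ) := by
  rw [realPairTerm_conv_reflect hg, weilMellin_half_sub_of_isEven he, Complex.mul_conj,
    Complex.normSq_eq_norm_sq]
  push_cast
  ring

/-- ODD tests: `realPairTerm η (g ⋆ g̃) = −2‖ĝ(1/2+η)‖² ≤ 0`. [folklore] -/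
theorem realPairTerm_of_isOdd {g : ℝ → ℂ} (hg : IsWeilTest g) (ho : IsOdd g) (η : ℝ) :
    realPairTerm η (weilConv g (weilReflect g)) =
      -(((2 * ‖weilMellin g ((1 / 2 + η : ℝ) : ℂ)‖ ^ 2 : ℝ) : ℂ)) := by
  rw [realPairTerm_conv_reflect hg, weilMellin_half_sub_of_isOdd ho, map_neg, mul_neg, neg_mul,
    Complex.mul_conj, Complex.normSq_eq_norm_sq]
  push_cast
  ring

/-- EVEN tests: `Re Q_pair(g) = Re Q_ζ(g) + 2‖ĝ(1/2+η)‖²`. [folklore] -/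
theorem realPairDatum_re_quadratic_of_isEven {g : ℝ → ℂ} (hg : IsWeilTest g) (he : IsEven g)
    (η : ℝ) : ((realPairDatum η).quadratic g).re =
      (zetaDatum.quadratic g).re + 2 * ‖weilMellin g ((1 / 2 + η : ℝ) : ℂ)‖ ^ 2 := by
  rw [realPairDatum_quadratic, realPairTerm_of_isEven hg he, Complex.add_re, Complex.ofReal_re]

/-- ODD tests: `Re Q_pair(g) = Re Q_ζ(g) − 2‖ĝ(1/2+η)‖²`. [folklore] -/
theorem realPairDatum_re_quadratic_of_isOdd {g : ℝ → ℂ} (hg : IsWeilTest g) (ho : IsOdd g)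
    (η : ℝ) : ((realPairDatum η).quadratic g).re =
      (zetaDatum.quadratic g).re - 2 * ‖weilMellin g ((1 / 2 + η : ℝ) : ℂ)‖ ^ 2 := by
  rw [realPairDatum_quadratic, realPairTerm_of_isOdd hg ho, Complex.add_re, Complex.neg_re,
    Complex.ofReal_re]
  ring

/-! ## Even-sector domination and EVEN-MONOTONE criteria (REALPAIR-MONO) -/

namespace ExplicitDatum

/-- `F ≤ₑ G`: the even-sector form of `G` dominates that of `F` (real parts, all even tests). [folklore] -/
def EvenDominates (F G : ExplicitDatum) : Prop :=
  ∀ g : ℝ → ℂ, IsWeilTest g → IsEven g → (F.quadratic g).re ≤ (G.quadratic g).re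

/-- `F ≤ₒ G`: odd-sector domination. [folklore] -/
def OddDominates (F G : ExplicitDatum) : Prop :=
  ∀ g : ℝ → ℂ, IsWeilTest g → IsOdd g → (F.quadratic g).re ≤ (G.quadratic g).re

/-- Even-sector window positivity up to cutoff `A`. [folklore] -/
def EvenPositivityOn (F : ExplicitDatum) (A : ℝ) : Prop :=
  ∀ g : ℝ → ℂ, IsWeilTest g → IsEven g → tsupport g ⊆ Icc (-A) A → 0 ≤ (F.quadratic g).re

/-- Even-sector positivity on even REAL-valued tests (the tree's even Weil criterion). [folklore] -/
def EvenRealPositivity (F : ExplicitDatum) : Prop :=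
  ∀ g : ℝ → ℂ, IsWeilTest g → IsEven g → (∀ t : ℝ, (g t).im = 0) → 0 ≤ (F.quadratic g).re

end ExplicitDatum

open ExplicitDatum

/-- A criterion is EVEN-MONOTONE if it is inherited upward along even-sector domination
(every PSD-monotone functional of the even block: even window positivity, even ground-energy
floors, even Sylvester / signature counts read as lower bounds). [folklore] -/
def IsEvenMonotone (P : ExplicitDatum → Prop) : Prop :=
  ∀ F G : ExplicitDatum, F.EvenDominates G → P F → P G

/-- **REALPAIR-MONO (PROVED)**: the planted real pair DOMINATES `ζ` in the even sector. [folklore] -/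
theorem zetaDatum_evenDominates_realPairDatum (η : ℝ) : zetaDatum.EvenDominates (realPairDatum η) := by
  intro g hg he
  rw [realPairDatum_re_quadratic_of_isEven hg he]
  have : 0 ≤ 2 * ‖weilMellin g ((1 / 2 + η : ℝ) : ℂ)‖ ^ 2 := by positivity
  linarith

/-- The pair is visible only in the ODD sector: there `ζ` dominates the control. [folklore] -/
theorem realPairDatum_oddDominated (η : ℝ) : (realPairDatum η).OddDominates zetaDatum := by
  intro g hg ho
  rw [realPairDatum_re_quadratic_of_isOdd hg ho]
  have : 0 ≤ 2 * ‖weilMellin g ((1 / 2 + η : ℝ) : ℂ)‖ ^ 2 := by positivity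
  linarith

/-- **PROVED**: every even-monotone criterion holding at `ζ` holds at every planted real pair. [folklore] -/
theorem realPair_of_isEvenMonotone {P : ExplicitDatum → Prop} (hP : IsEvenMonotone P)
    (hζ : P zetaDatum) (η : ℝ) : P (realPairDatum η) :=
  hP _ _ (zetaDatum_evenDominates_realPairDatum η) hζ

/-- **WALL (REALPAIR-MONO, PROVED, RH-free)**: no even-monotone criterion discriminates `ζ` from a
class of negatives containing a planted real pair (negativity of the control is the binder `hNeg`,
never asserted). [folklore] -/
theorem no_evenMonotone_discriminator {P : ExplicitDatum → Prop} (hP : IsEvenMonotone P)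
    {Neg : Set ExplicitDatum} {η : ℝ} (hNeg : realPairDatum η ∈ Neg) :
    ¬ Discriminates P zetaDatum Neg :=
  fun h ↦ h.2 _ hNeg (realPair_of_isEvenMonotone hP h.1 η)

/-- Even window positivity at a cutoff is even-monotone. [folklore] -/
theorem evenPositivityOn_isEvenMonotone (A : ℝ) : IsEvenMonotone fun F ↦ F.EvenPositivityOn A :=
  fun _ _ hFG hF g hg he hsupp ↦ (hF g hg he hsupp).trans (hFG g hg he)

/-- The even real-test criterion is even-monotone. [folklore] -/
theorem evenRealPositivity_isEvenMonotone : IsEvenMonotone fun F ↦ F.EvenRealPositivity :=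
  fun _ _ hFG hF g hg he him ↦ (hF g hg he him).trans (hFG g hg he)

/-- **PROVED**: even window positivity transfers from `ζ` to every planted real pair, at every cutoff. [folklore] -/
theorem evenPositivityOn_realPairDatum {A : ℝ} (h : zetaDatum.EvenPositivityOn A) (η : ℝ) :
    (realPairDatum η).EvenPositivityOn A :=
  realPair_of_isEvenMonotone (evenPositivityOn_isEvenMonotone A) h η

/-- **PROVED**: the even real-test Weil criterion transfers from `ζ` to every planted real pair. [folklore] -/
theorem evenRealPositivity_realPairDatum (h : zetaDatum.EvenRealPositivity) (η : ℝ) :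
    (realPairDatum η).EvenRealPositivity :=
  realPair_of_isEvenMonotone evenRealPositivity_isEvenMonotone h η

/-- CONTEXT (tree `riemannHypothesis_iff_evenWeilPositivity`): for `ζ` itself the even real-test
criterion IS `RiemannHypothesis` — yet it cannot see a planted real pair
(`evenRealPositivity_realPairDatum`). [folklore] -/
theorem evenRealPositivity_zetaDatum_iff : zetaDatum.EvenRealPositivity ↔ RiemannHypothesis := by
  rw [RuelleBandExactFirstBand.riemannHypothesis_iff_evenWeilPositivity]
  simp only [ExplicitDatum.EvenRealPositivity, IsEven, zetaDatum_quadratic]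

/-- **COROLLARY (PROVED)**: under `RiemannHypothesis` every planted real pair passes the even
real-test Weil criterion — the even sector alone cannot distinguish `ζ` from `ζ` with real zeros
off the line. [folklore] -/
theorem evenRealPositivity_realPairDatum_of_riemannHypothesis (hRH : RiemannHypothesis) (η : ℝ) :
    (realPairDatum η).EvenRealPositivity :=
  evenRealPositivity_realPairDatum (evenRealPositivity_zetaDatum_iff.mpr hRH) η

end Summit.RiemannHypothesis.RiemannHypothesis.Theorems.PfPersistenceBarrier
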